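import Summits.ResolutionOfSingularities.ResolutionOfSingularities.Theorems.PurelyInseparableDim4ClosedPoints
import Summits.ResolutionOfSingularities.ResolutionOfSingularities.Theorems.PurelyInseparableDim4EquimultipleHasse
import Literature.AlgebraicGeometry.Resolution.CartierDivisorControlledTransformReduced
import HarnessLib

/-!
# Purely inseparable four-folds: the transform OFF the centre, and the full closed support after one blow-up
# (brick TY-3h «OFF-CENTRE», cell `res-dim4-pi`)

[OURS · counted 0] (D-0157 DOOR 2; completes the description of the support of the transformed marked ideal begun in
TY-3e/TY-3f/TY-3g; host item stmt-ResolutionOfSingularities-16155, helper). Nothing here proves resolution of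
singularities in dimension ≥ 4 / characteristic `p`.

Off the centre a blowing up is a local isomorphism, so the controlled transform `σᶜ((z^p + F), p)` has at `w` the
order of `(z^p + F)` at `π w` (tree `IsBlowup.idealOrder_controlledTransform_eq_of_not_mem`, Stacks 02OS); closed
points of `W` go to closed points of `𝔸⁵_K` (`π` is proper); and TY-3/TY-3b read `ord_{(a,b)}(z^p + F) ≥ p` as
`a^p + F(b) = 0 ∧ b ∈ V(J_p⁺(F))`. Together with the Edge dictionary over the centre (TY-3f) this is the complete
list of CLOSED points of the new order-`p` locus after ONE permissible blow-up — the set the marked procedure of the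
target frame must treat next.

* `idealOrder_controlledTransform_of_not_mem_CΛ`, `le_idealOrder_controlledTransform_iff_of_not_mem_CΛ` — off
  `V(z, x_S)` the order is that of the original hypersurface at `π w`;
* `isClosed_singleton_π` — `π w` is closed for `w` closed;
* `natCast_le_idealOrder_hypSheaf_iff_hasse` (`K` any field, rational point `(a, b)`): `p ≤ ord_{(a,b)}(z^p + G) ↔
  a^p + G(b) = 0 ∧ ∀ α ≠ 0, |α| < p → (D^{(α)} G)(b) = 0`;
* **`le_idealOrder_controlledTransform_iff_of_isClosed_of_not_mem_CΛ`** (`K = K̄`): a CLOSED `w` off the centre has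
  `ord_w σᶜ ≥ p` iff `π w = (a, b)` with `a^p + F(b) = 0` and all Hasse derivatives `D^{(α)}F`, `0 < |α| < p`,
  vanishing at `b`;
* **`closedSupport_transform_cases`** — every CLOSED point of `W` of order `≥ p` is EITHER over the centre and then a
  `PIDim4.Edge` successor `chartImm_j (a, b)` (TY-3f), OR off the centre and then over a closed order-`p` point of
  `V(z^p + F) ∖ V(z, x_S)`.

AI-produced formalisation, weaker than expert review. bears_on: LADDER-RESOLUTION:D157-DOOR2 (res-dim4-pi · TY-3h).
-/

set_option linter.dupNamespace false -- D-0017: single-problem summit path `Summit.<S>.<S>.…` by design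

noncomputable section

open MvPolynomial Finset CategoryTheory AlgebraicGeometry Opposite

namespace Summit.ResolutionOfSingularities.ResolutionOfSingularities.Theorems.PIDim4

open Literature.AlgebraicGeometry.Resolution
open Literature.AlgebraicGeometry.Resolution.Hauser2010
open Literature.AlgebraicGeometry.Resolution.AffinePointBlowup (P A γ coord Wtop)

namespace Equimultiple

section OffCentre

variable {K : Type} [Field K] {p : ℕ} [hp : Fact p.Prime] [CharP K p]
variable {S : Finset (Fin 4)} {W : Scheme.{0}} {π : W ⟶ P 4 K}

omit hp [CharP K p] in
/-- **Off the centre the controlled transform has the order of the original hypersurface**: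
`π w ∉ V(z, x_S) ⇒ ord_w σᶜ((z^p + F), p) = ord_{π w} (z^p + F)`. [cite: StacksProject, Tag 02OS] -/
theorem idealOrder_controlledTransform_of_not_mem_CΛ (F : MvPolynomial (Fin 4) K)
    (hπ : IsBlowup π (AffineCoordBlowup.𝓘Λ 4 K (insert 0 (Fin.succ '' (S : Set (Fin 4)))))) {w : W}
    (hw : π w ∉ AffineCoordBlowup.CΛ 4 K (insert 0 (Fin.succ '' (S : Set (Fin 4))))) :
    idealOrder (controlledTransform π (AffineCoordBlowup.𝓘Λ 4 K (insert 0 (Fin.succ '' (S : Set (Fin 4)))))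
        (hypSheaf p F) p) w = idealOrder (hypSheaf p F) (π w) := by
  apply hπ.idealOrder_controlledTransform_eq_of_not_mem
  rwa [AffineCoordBlowup.support_𝓘Λ]

omit hp [CharP K p] in
/-- `π w` is a closed point of `𝔸⁵_K` when `w` is a closed point of the blow-up (`π` is proper).
[cite: StacksProject, Tag 01W0 (proper morphisms are universally closed)] -/
theorem isClosed_singleton_π {Λ : Set (Fin (4 + 1))} (hπ : IsBlowup π (AffineCoordBlowup.𝓘Λ 4 K Λ)) {w : W}
    (hw : IsClosed ({w} : Set W)) : IsClosed ({π w} : Set (P 4 K)) := by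
  haveI : IsProper π := hπ.isProper
  rw [← Set.image_singleton]
  exact π.isClosedMap _ hw

omit hp [CharP K p] in
/-- **The order-`p` criterion for `z^p + G` at a rational point, Hasse form** (any field): `p ≤ ord_{(a,b)}(z^p + G)`
iff `a^p + G(b) = 0` and every Hasse derivative `D^{(α)} G`, `0 < |α| < p`, vanishes at `b` (TY-3 + TY-3b's Taylor
formula). [cite: Hauser2010, §F (equiconstant points)] [cite: EGAIV4, Thm. 16.11.2] -/
theorem natCast_le_idealOrder_hypSheaf_iff_hasse [Fact p.Prime] [CharP K p] (G : MvPolynomial (Fin 4) K) (a : K)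
    (b : Fin 4 → K) {x : P 4 K} (hx : x.asIdeal = MvPolynomial.vanishingIdeal K {(Fin.cons a b : Fin (4 + 1) → K)}) :
    (p : ℕ∞) ≤ idealOrder (hypSheaf p G) x ↔
      a ^ p + MvPolynomial.eval b G = 0 ∧
        ∀ α : Fin 4 →₀ ℕ, α ≠ 0 → α.degree < p → MvPolynomial.eval b (hasseDeriv K α G) = 0 := by
  rw [natCast_le_idealOrder_hypSheaf_iff G hx, natCast_le_ordZero_translate_hyp_iff]
  simp only [coeff_translate_eq_eval_hasseDeriv]

/-- **A closed point OFF the centre is a point of order `≥ p` of the transform iff it lies over a closed order-`p`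
point of the original hypersurface** (`K` algebraically closed): `π w = (a, b)` rational with `a^p + F(b) = 0` and
`(D^{(α)} F)(b) = 0` for `0 < |α| < p`. [cite: StacksProject, Tag 02OS] [cite: Hauser2010, §F (equiconstant points)] -/
theorem le_idealOrder_controlledTransform_iff_of_isClosed_of_not_mem_CΛ [IsAlgClosed K] (F : MvPolynomial (Fin 4) K)
    (hπ : IsBlowup π (AffineCoordBlowup.𝓘Λ 4 K (insert 0 (Fin.succ '' (S : Set (Fin 4)))))) {w : W}
    (hw : IsClosed ({w} : Set W))
    (hwC : π w ∉ AffineCoordBlowup.CΛ 4 K (insert 0 (Fin.succ '' (S : Set (Fin 4))))) :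
    (p : ℕ∞) ≤ idealOrder (controlledTransform π
        (AffineCoordBlowup.𝓘Λ 4 K (insert 0 (Fin.succ '' (S : Set (Fin 4))))) (hypSheaf p F) p) w ↔
      ∃ (a : K) (b : Fin 4 → K),
        (π w).asIdeal = MvPolynomial.vanishingIdeal K {(Fin.cons a b : Fin (4 + 1) → K)} ∧
          a ^ p + MvPolynomial.eval b F = 0 ∧
            ∀ α : Fin 4 →₀ ℕ, α ≠ 0 → α.degree < p → MvPolynomial.eval b (hasseDeriv K α F) = 0 := by
  rw [idealOrder_controlledTransform_of_not_mem_CΛ F hπ hwC]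
  obtain ⟨a, b, hab⟩ := exists_eq_vanishingIdeal_cons_of_isClosed (isClosed_singleton_π hπ hw)
  constructor
  · intro h
    exact ⟨a, b, hab, (natCast_le_idealOrder_hypSheaf_iff_hasse F a b hab).mp h⟩
  · rintro ⟨a', b', hab', h⟩
    exact (natCast_le_idealOrder_hypSheaf_iff_hasse F a' b' hab').mpr h

/-- **The closed support of the transform after one permissible blow-up, case by case.** `K` algebraically closed,
`s` a presented state with `F ≠ 0` clean and `V(z, x_S)` Hironaka-permissible, `π` ANY blowing up along it, `w` a
CLOSED point of `W` with `ord_w σᶜ((z^p + F), p) ≥ p`. Then EITHER `w` lies over the centre and is the point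
`chartImm_j (a, b)` of an EDGE `Edge p S s (step p S j b s)` of the frame (with `a^p + F′_j(b) = 0`), OR `w` lies off
the centre, over the closed point `(a, b)` of `V(z^p + F) ∖ V(z, x_S)` with `a^p + F(b) = 0` and all
`(D^{(α)}F)(b) = 0`, `0 < |α| < p`. [cite: Hauser2010, §F] [cite: BierstoneGrigorievMilmanWlodarczyk2011, §3.2] -/
theorem closedSupport_transform_cases [IsAlgClosed K] [DecidableEq K] (s : State K) (hF : s.F ≠ 0)
    (hclean : Literature.Barriers.ResolutionOfSingularities.HauserPerlega.IsClean p s.F)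
    (hS : IsPermissibleCentre p S s.F)
    (hπ : IsBlowup π (AffineCoordBlowup.𝓘Λ 4 K (insert 0 (Fin.succ '' (S : Set (Fin 4)))))) {w : W}
    (hw : IsClosed ({w} : Set W))
    (hord : (p : ℕ∞) ≤ idealOrder (controlledTransform π
      (AffineCoordBlowup.𝓘Λ 4 K (insert 0 (Fin.succ '' (S : Set (Fin 4))))) (hypSheaf p s.F) p) w) :
    (∃ (j : Fin 4) (hj : j ∈ S) (x : P 4 K) (a : K) (b : Fin 4 → K),
        AffineCoordBlowup.chartImm hπ (ChartDictionary.succ_mem_centreVars hj) x = w ∧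
          x.asIdeal = MvPolynomial.vanishingIdeal K {(Fin.cons a b : Fin (4 + 1) → K)} ∧
            a ^ p + MvPolynomial.eval b (CentreBlowup.chartTransform p S j s.F) = 0 ∧
              Edge p S s (CentreBlowup.step p S j b s)) ∨
      (π w ∉ AffineCoordBlowup.CΛ 4 K (insert 0 (Fin.succ '' (S : Set (Fin 4)))) ∧
        ∃ (a : K) (b : Fin 4 → K),
          (π w).asIdeal = MvPolynomial.vanishingIdeal K {(Fin.cons a b : Fin (4 + 1) → K)} ∧
            a ^ p + MvPolynomial.eval b s.F = 0 ∧
              ∀ α : Fin 4 →₀ ℕ, α ≠ 0 → α.degree < p → MvPolynomial.eval b (hasseDeriv K α s.F) = 0) := by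
  by_cases hwC : π w ∈ AffineCoordBlowup.CΛ 4 K (insert 0 (Fin.succ '' (S : Set (Fin 4))))
  · exact Or.inl (exists_edge_of_le_idealOrder s hF hclean hS hπ hw hwC hord)
  · exact Or.inr ⟨hwC, (le_idealOrder_controlledTransform_iff_of_isClosed_of_not_mem_CΛ s.F hπ hw hwC).mp hord⟩

end OffCentre

end Equimultiple

end Summit.ResolutionOfSingularities.ResolutionOfSingularities.Theorems.PIDim4

end
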